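import Summits.BirchSwinnertonDyer.Rank1Residual.GaloisImage.KolyvaginInjectivityAllDepths
import HarnessLib

/-!
# Injectivity of evaluation on `KS(E[3^k·3], 𝓕_can)` at every depth — the CONSUMER form with the
# level hypotheses bounded by the target depth
# (cell `b2b-bsdres`, team n1011, row T-INJ-DEV-K, file K3; seat p11 GEN 6; lead R5-69/R5-70;
# skeleton `cells/n1011/skel/T-INJ-DEV-FB.md`)

HONEST FRAMING (cell `b2b-bsdres`, run/shared/lean/b2b/bsd-rank1-residual/, verbatim in every
file): the goal of the cell is to DELETE the COMBINATION-SHAPED residual classes of the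
Birch–Swinnerton-Dyer formula for ALL analytic-rank `≤ 1` elliptic curves over `ℚ` — "full BSD
formula for every rank `≤ 1` curve in class `C`" assembled STRICTLY from published theorems — so
that the rank-`≤ 1` remainder becomes exactly the CONSTRUCTION-SHAPED classes, which are TYPED
(missing-input `Prop`s), NOT attempted. This is not "finishing BSD". Team n1011 (N10 / N11, the
additive block X4 ∧ `p = 3`): research route on the CONSTRUCTION-SHAPED class X4; TOOL theorems; no
class theorem; nothing is booked; no label and no RESIDUAL-MAP mark is moved. Theorems only: no
definition, no named fact, no `sorry`.

## What and why

`TorsionLevel.apply_eq_zero_of_apply_eq_zero_allDepths` (K2, `KolyvaginInjectivityAllDepths.lean`)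
asks its level-`j` hypotheses — (H.2)-cokernels, canonical comparison maps, admissibility, primes
`= P` — for EVERY `j : ℕ`.  That over-asks: Kolyvagin data on `E[3^j·3]` with THE canonical
comparison maps at level `3^{j+1}` on a prime set inside the class of level `3^{k+1}` exist only for
`j ≤ k` in general (the predicate `IsFiniteSingularComparisonWith` needs
`det(1 − Frob_𝔮 | E[3^{j+1}]) ≡ 0 (mod 3^{j+1})`, i.e. `𝔮` in the class of level `3^{j+1}`).  This
file gives the forms with the families bounded by the target depth `k` (`∀ j ≤ k`), by the same
induction (`Nat.le_induction` from n1011-p15's `apply_eq_zero_of_apply_eq_zero_levelTwo` through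
`TorsionLevel.apply_eq_zero_of_apply_eq_zero_succ`); the levels `> k` of the family `D` are never
used (any data may be supplied there).  These are the forms END-level consumers should call.

References: R. Sakamoto, JTNB 36 (2024) Thm. 4.4 (1) [Sakamoto2024]; K. Rubin, PCMI 18 (2011)
Cor. 2.8.9 [Rubin2011]; B. Mazur, K. Rubin, Mem. AMS 799 (2004) Thm. 4.4.1, §4.5.
-/

noncomputable section

open scoped Classical NumberField ContRepresentation
open Field NumberField IsDedekindDomain Module
open WeierstrassCurve Literature.NumberTheory.EllipticCurves Literature.NumberTheory.GaloisRepresentations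
  Literature.NumberTheory.GaloisRepresentations.DiscreteGaloisModule Literature.NumberTheory.GaloisCohomology
open Summit.BirchSwinnertonDyer.Rank1Residual.GaloisImage.KSDevissage

namespace Summit.BirchSwinnertonDyer.Rank1Residual.GaloisImage.TorsionLevel

variable (W : WeierstrassCurve ℚ) [W.IsElliptic]

/-! ### All depths, level families bounded by the target depth -/

/-- **Injectivity of evaluation on `KS(E[3^k·3], 𝓕_can)` at every depth `k ≥ 1` from the `m = 1`
injectivity — level hypotheses for `j ≤ k` only** (same proof as `…_allDepths`: `Nat.le_induction`
from n1011-p15's `apply_eq_zero_of_apply_eq_zero_levelTwo` through `…_succ`; the levels `> k` of the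
family `D` are never used). [cite: Sakamoto2024, Thm. 4.4 (1) (p. 926)] [cite: Rubin2011, Cor. 2.8.9 (p. 25)] -/
theorem apply_eq_zero_of_apply_eq_zero_allDepths_le [Finite (geomTorsion W ((3 : ℕ) : ℤ))]
    (h0₁ : ∀ P : geomTorsion W ((3 : ℕ) : ℤ),
      (∀ σ : absoluteGaloisGroup ℚ, W.torsionGaloisModule ((3 : ℕ) : ℤ) σ P = P) → P = 0)
    {S : Finset (Place ℚ)} (h𝓕₁ : (propagatedSelmerStructureOne W 3).IsUnramifiedOutside S)
    {Sset : Set (HeightOneSpectrum (𝓞 ℚ))} {τ : absoluteGaloisGroup ℚ}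
    (hτ₁ : Nonempty (cokerSubOne (W.torsionGaloisModule ((3 : ℕ) : ℤ)) τ ≃+ ZMod 3))
    (D : (j : ℕ) → KolyvaginDatum (W.torsionGaloisModule (((3 : ℕ) : ℤ) ^ j * ((3 : ℕ) : ℤ))))
    (D₁ : KolyvaginDatum (W.torsionGaloisModule ((3 : ℕ) : ℤ)))
    {P : Set (HeightOneSpectrum (𝓞 ℚ))} (hP₁ : D₁.primes = P) (hPS : ∀ q ∈ P, (Sum.inr q : Place ℚ) ∉ S)
    (hT₁ : D₁.transverse = cyclotomicTransverse _)
    {η : (q : HeightOneSpectrum (𝓞 ℚ)) → (ZMod (Ideal.absNorm q.asIdeal))ˣ}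
    (hD₁ : D₁.HasCanonicalComparison 3 η)
    {n₀ : Finset (HeightOneSpectrum (𝓞 ℚ))}
    (hinj₁ : ∀ lam : Finset (HeightOneSpectrum (𝓞 ℚ)) →
        galoisCohomology (W.torsionGaloisModule ((3 : ℕ) : ℤ)) 1,
      D₁.IsKolyvaginSystem (propagatedSelmerStructureOne W 3) lam → lam n₀ = 0 → ∀ n, lam n = 0)
    (k : ℕ) (hk : 1 ≤ k)
    (h0 : ∀ j, j ≤ k → ∀ P : geomTorsion W (((3 : ℕ) : ℤ) ^ j * ((3 : ℕ) : ℤ)),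
      (∀ σ : absoluteGaloisGroup ℚ,
        W.torsionGaloisModule (((3 : ℕ) : ℤ) ^ j * ((3 : ℕ) : ℤ)) σ P = P) → P = 0)
    (h𝓕 : ∀ j, j ≤ k → (propagatedSelmerStructure W 3 j).IsUnramifiedOutside S)
    (hτμ : τ ∈ rootsOfUnityFixer ℚ (3 ^ (k + 1)))
    (hτ : ∀ j, j ≤ k → Nonempty (cokerSubOne (W.torsionGaloisModule (((3 : ℕ) : ℤ) ^ j * ((3 : ℕ) : ℤ))) τ ≃+
      ZMod (3 ^ (j + 1))))
    (hP : ∀ j, j ≤ k → (D j).primes = P)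
    (hPc : P ⊆ frobeniusClassPrimes
      (W.torsionGaloisModule (((3 : ℕ) : ℤ) ^ k * ((3 : ℕ) : ℤ))) Sset τ (3 ^ (k + 1)))
    (hT : ∀ j, j ≤ k → (D j).transverse = cyclotomicTransverse _)
    (hD : ∀ j, j ≤ k → (D j).HasCanonicalComparison (3 ^ (j + 1)) η)
    (hadm : ∀ j, j ≤ k → (D j).IsAdmissible)
    {κ : Finset (HeightOneSpectrum (𝓞 ℚ)) →
      galoisCohomology (W.torsionGaloisModule (((3 : ℕ) : ℤ) ^ k * ((3 : ℕ) : ℤ))) 1}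
    (hκ : (D k).IsKolyvaginSystem (propagatedSelmerStructure W 3 k) κ) (h0κ : κ n₀ = 0)
    (n : Finset (HeightOneSpectrum (𝓞 ℚ))) : κ n = 0 := by
  induction k, hk using Nat.le_induction generalizing n with
  | base =>
    exact apply_eq_zero_of_apply_eq_zero_levelTwo W h0₁ (h𝓕 1 le_rfl) h𝓕₁ hτμ (hτ 1 le_rfl) hτ₁
      (hP₁.trans (hP 1 le_rfl).symm) (by rw [hP 1 le_rfl]; exact hPc)
      (fun q hq => hPS q ((hP 1 le_rfl) ▸ hq)) (hT 1 le_rfl) hT₁ (hD 1 le_rfl) hD₁ (hadm 1 le_rfl)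
      hinj₁ hκ h0κ n
  | succ k hk ih =>
    have hdvd : 3 ^ (k + 1) ∣ 3 ^ (k + 1 + 1) := pow_dvd_pow 3 (Nat.le_succ _)
    have hker : ∀ u : absoluteGaloisGroup ℚ,
        W.torsionGaloisModule (((3 : ℕ) : ℤ) ^ (k + 1) * ((3 : ℕ) : ℤ)) u = 1 →
          W.torsionGaloisModule (((3 : ℕ) : ℤ) ^ k * ((3 : ℕ) : ℤ)) u = 1 := fun u hu =>
      torsionGaloisModule_eq_one_of_dvd W (Transport.pow_mul_dvd_pow_mul (Nat.le_succ k)) u hu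
    have hPc' : P ⊆ frobeniusClassPrimes (W.torsionGaloisModule (((3 : ℕ) : ℤ) ^ k * ((3 : ℕ) : ℤ)))
        Sset τ (3 ^ (k + 1)) := fun q hq =>
      S24Deep.frobeniusClassPrimes_mono _ _ hker Sset τ hdvd (hPc hq)
    have hτμ' : τ ∈ rootsOfUnityFixer ℚ (3 ^ (k + 1)) := rootsOfUnityFixer_le_of_dvd ℚ hdvd hτμ
    have hle : k ≤ k + 1 := Nat.le_succ k
    exact apply_eq_zero_of_apply_eq_zero_succ W k (h0 k hle) (h𝓕 (k + 1) le_rfl) h𝓕₁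
      hτμ (hτ (k + 1) le_rfl) (hτ k hle) hτ₁ (hP₁.trans (hP _ le_rfl).symm)
      ((hP k hle).trans (hP _ le_rfl).symm)
      (by rw [hP (k + 1) le_rfl]; exact hPc) (fun q hq => hPS q ((hP (k + 1) le_rfl) ▸ hq))
      (hT _ le_rfl) (hT _ hle) hT₁ (hD (k + 1) le_rfl) (hD k hle) hD₁ (hadm (k + 1) le_rfl) hinj₁
      (fun μ hμ hμ0 m => ih (fun j hj => h0 j (hj.trans hle)) (fun j hj => h𝓕 j (hj.trans hle)) hτμ'
        (fun j hj => hτ j (hj.trans hle)) (fun j hj => hP j (hj.trans hle)) hPc'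
        (fun j hj => hT j (hj.trans hle)) (fun j hj => hD j (hj.trans hle))
        (fun j hj => hadm j (hj.trans hle)) hμ hμ0 m)
      hκ h0κ n

/-- **Evaluation at `n₀` is injective on `KS(E[3^k·3], 𝓕_can, D k)` for every `k ≥ 1` — level
hypotheses for `j ≤ k` only** (subgroup form of `apply_eq_zero_of_apply_eq_zero_allDepths_le`).
[cite: Sakamoto2024, Thm. 4.4 (1) (p. 926)] [cite: Rubin2011, Cor. 2.8.9 (p. 25)] -/
theorem injective_eval_kolyvaginSystems_allDepths_le [Finite (geomTorsion W ((3 : ℕ) : ℤ))]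
    (h0₁ : ∀ P : geomTorsion W ((3 : ℕ) : ℤ),
      (∀ σ : absoluteGaloisGroup ℚ, W.torsionGaloisModule ((3 : ℕ) : ℤ) σ P = P) → P = 0)
    {S : Finset (Place ℚ)} (h𝓕₁ : (propagatedSelmerStructureOne W 3).IsUnramifiedOutside S)
    {Sset : Set (HeightOneSpectrum (𝓞 ℚ))} {τ : absoluteGaloisGroup ℚ}
    (hτ₁ : Nonempty (cokerSubOne (W.torsionGaloisModule ((3 : ℕ) : ℤ)) τ ≃+ ZMod 3))
    (D : (j : ℕ) → KolyvaginDatum (W.torsionGaloisModule (((3 : ℕ) : ℤ) ^ j * ((3 : ℕ) : ℤ))))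
    (D₁ : KolyvaginDatum (W.torsionGaloisModule ((3 : ℕ) : ℤ)))
    {P : Set (HeightOneSpectrum (𝓞 ℚ))} (hP₁ : D₁.primes = P) (hPS : ∀ q ∈ P, (Sum.inr q : Place ℚ) ∉ S)
    (hT₁ : D₁.transverse = cyclotomicTransverse _)
    {η : (q : HeightOneSpectrum (𝓞 ℚ)) → (ZMod (Ideal.absNorm q.asIdeal))ˣ}
    (hD₁ : D₁.HasCanonicalComparison 3 η)
    {n₀ : Finset (HeightOneSpectrum (𝓞 ℚ))}
    (hinj₁ : ∀ lam : Finset (HeightOneSpectrum (𝓞 ℚ)) →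
        galoisCohomology (W.torsionGaloisModule ((3 : ℕ) : ℤ)) 1,
      D₁.IsKolyvaginSystem (propagatedSelmerStructureOne W 3) lam → lam n₀ = 0 → ∀ n, lam n = 0)
    (k : ℕ) (hk : 1 ≤ k)
    (h0 : ∀ j, j ≤ k → ∀ P : geomTorsion W (((3 : ℕ) : ℤ) ^ j * ((3 : ℕ) : ℤ)),
      (∀ σ : absoluteGaloisGroup ℚ,
        W.torsionGaloisModule (((3 : ℕ) : ℤ) ^ j * ((3 : ℕ) : ℤ)) σ P = P) → P = 0)
    (h𝓕 : ∀ j, j ≤ k → (propagatedSelmerStructure W 3 j).IsUnramifiedOutside S)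
    (hτμ : τ ∈ rootsOfUnityFixer ℚ (3 ^ (k + 1)))
    (hτ : ∀ j, j ≤ k → Nonempty (cokerSubOne (W.torsionGaloisModule (((3 : ℕ) : ℤ) ^ j * ((3 : ℕ) : ℤ))) τ ≃+
      ZMod (3 ^ (j + 1))))
    (hP : ∀ j, j ≤ k → (D j).primes = P)
    (hPc : P ⊆ frobeniusClassPrimes
      (W.torsionGaloisModule (((3 : ℕ) : ℤ) ^ k * ((3 : ℕ) : ℤ))) Sset τ (3 ^ (k + 1)))
    (hT : ∀ j, j ≤ k → (D j).transverse = cyclotomicTransverse _)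
    (hD : ∀ j, j ≤ k → (D j).HasCanonicalComparison (3 ^ (j + 1)) η)
    (hadm : ∀ j, j ≤ k → (D j).IsAdmissible) :
    Function.Injective fun κ : (D k).kolyvaginSystems (propagatedSelmerStructure W 3 k) => κ.1 n₀ := by
  intro κ κ' hκκ'
  have hmem : κ.1 - κ'.1 ∈ (D k).kolyvaginSystems (propagatedSelmerStructure W 3 k) := sub_mem κ.2 κ'.2
  have hd0 : (κ.1 - κ'.1) n₀ = 0 := by
    change κ.1 n₀ - κ'.1 n₀ = 0
    exact sub_eq_zero.mpr hκκ'
  have hall := apply_eq_zero_of_apply_eq_zero_allDepths_le W h0₁ h𝓕₁ hτ₁ D D₁ hP₁ hPS hT₁ hD₁ hinj₁ k hk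
    h0 h𝓕 hτμ hτ hP hPc hT hD hadm ((KolyvaginDatum.mem_kolyvaginSystems_iff _ _ _).mp hmem) hd0
  apply Subtype.ext
  funext m
  exact sub_eq_zero.mp (hall m)

end Summit.BirchSwinnertonDyer.Rank1Residual.GaloisImage.TorsionLevel

end
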